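import Mathlib.RingTheory.Filtration
import Mathlib.RingTheory.Jacobson.Ideal
import HarnessLib

/-!
# Venture HSemireg — purity lifts along a one-parameter deformation (the Krull skeleton)

The algebraic skeleton of «PURITY LIFTS ALONG FLAT DEFORMATIONS OVER A DISC» (cell record
`widen/W1/CLEAN-COMPONENT-THEOREM-w1tw1.md` §24, TGTBT line (ii), and §20 step (2)): let `M` be a
finite module over a Noetherian ring `R` (the stalk of the family `F_C` at a point of the special
fibre) and `t ∈ R` an element of the Jacobson radical (the parameter of the disc). Call a class `P`
of submodules of `M` («submodules supported in small dimension») *saturation-closed* if it is stable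
under `N ↦ (N : t) = {m | t • m ∈ N}` (`= N.comap (t • ·)`), and suppose every `N ∈ P` dies in the special fibre:
`N ≤ t • M` (this is the purity of `M ⧸ tM`). Then **every `N ∈ P` is zero**: `N = t·(N : t)`,
iterate, and apply Krull's intersection theorem `⋂ₖ tᵏM = 0`.

* `mem_comap_lsmul` — `(N : t)` as the comap under `LinearMap.lsmul R M t` (no new definition);
* `le_pow_smul_top_of_forall` — the induction `N ≤ tᵏ • M` for all `k`;
* `eq_bot_of_saturationClosed` — the conclusion `N = ⊥` (Krull: `Ideal.iInf_pow_smul_eq_bot_of_le_jacobson`).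

HONEST FRAMING. Elementary commutative algebra; Lean index of one bookkeeping step of a NEGATIVE
structure theorem of the computation cell `pub-hsemireg` (seat w1-tw-1, W1). No scheme, sheaf,
abelian variety or semiregularity map appears; nothing here says that HC, HC_CM or HC_AV holds, and
nothing here is a new case of anything.
-/

namespace Summit.Ventures.HSemireg

namespace SpecialisationPurity

universe u v

variable {R : Type u} [CommRing R] {M : Type v} [AddCommGroup M] [Module R M]

/-- Membership in the saturation `(N : t) := N.comap (t • ·) = {m | t • m ∈ N}` (no new
definition: the saturation is the pull-back of `N` under the linear map `LinearMap.lsmul R M t`).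
[cite: Matsumura1987, §8] -/
theorem mem_comap_lsmul {t : R} {N : Submodule R M} {m : M} :
    m ∈ N.comap (LinearMap.lsmul R M t) ↔ t • m ∈ N := by
  simp

/-- **The induction.** If a class `P` of submodules is stable under saturation by `t` and every
member of `P` lies in `t • M`, then every member of `P` lies in `tᵏ • M` for every `k`.
[cite: Matsumura1987, §8 Thm. 8.10] -/
theorem le_pow_smul_top_of_forall (t : R) (P : Submodule R M → Prop)
    (hsat : ∀ N, P N → P (N.comap (LinearMap.lsmul R M t))) (hle : ∀ N, P N → N ≤ (Ideal.span {t}) • ⊤)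
    (k : ℕ) : ∀ N, P N → N ≤ (Ideal.span {t}) ^ k • (⊤ : Submodule R M) := by
  induction k with
  | zero => intro N _; simp
  | succ k ih =>
    intro N hN n hn
    -- `n ∈ N ≤ t • M`: write `n = t • m`
    have hn' : n ∈ (Ideal.span {t}) • (⊤ : Submodule R M) := hle N hN hn
    rw [Submodule.ideal_span_singleton_smul, Submodule.mem_smul_pointwise_iff_exists] at hn'
    obtain ⟨m, -, rfl⟩ := hn'
    -- `m ∈ (N : t)`, which is again in `P`, hence `m ∈ tᵏ • M`
    have hm : m ∈ N.comap (LinearMap.lsmul R M t) := mem_comap_lsmul.mpr hn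
    have hmk : m ∈ (Ideal.span {t}) ^ k • (⊤ : Submodule R M) := ih _ (hsat N hN) hm
    -- so `t • m ∈ t^(k+1) • M`
    rw [pow_succ', Submodule.mul_smul]
    exact Submodule.smul_mem_smul (Ideal.mem_span_singleton_self t) hmk

/-- **Purity lifts (Krull skeleton).** `R` Noetherian, `M` finite, `t` in the Jacobson radical of `R`
(e.g. `R` local and `t` a non-unit — the deformation parameter). If a class `P` of submodules of `M`
is stable under saturation by `t` and every member of `P` is contained in `t • M` («dies in the
special fibre»), then every member of `P` is `0`. Geometric reading: a flat one-parameter deformation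
of a sheaf that is pure of dimension `d` has no embedded pieces of dimension `≤ d` (take `P` = «supported
in dimension `≤ d`»: such a subsheaf maps to a subsheaf of the special fibre of dimension `≤ d − 1`,
i.e. to `0`, and `(N : t)` has the same support bound). [cite: Matsumura1987, §8 Thm. 8.10] -/
theorem eq_bot_of_saturationClosed [IsNoetherianRing R] [Module.Finite R M] (t : R)
    (ht : Ideal.span {t} ≤ (⊥ : Ideal R).jacobson) (P : Submodule R M → Prop)
    (hsat : ∀ N, P N → P (N.comap (LinearMap.lsmul R M t))) (hle : ∀ N, P N → N ≤ (Ideal.span {t}) • ⊤)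
    (N : Submodule R M) (hN : P N) : N = ⊥ := by
  rw [eq_bot_iff]
  intro n hn
  have key : n ∈ (⨅ k : ℕ, (Ideal.span {t}) ^ k • (⊤ : Submodule R M)) :=
    Submodule.mem_iInf _ |>.mpr fun k => le_pow_smul_top_of_forall t P hsat hle k N hN hn
  rwa [Ideal.iInf_pow_smul_eq_bot_of_le_jacobson (I := Ideal.span {t}) ht] at key

end SpecialisationPurity

end Summit.Ventures.HSemireg
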